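import Summits.QuantumFields.BalabanUV.Beta.FP.CubicGermFunctional

/-!
# `BalabanUV.Beta.FP.CubicGermPairing` — road «FP» for binder row D1, sub-row H2-G-WARD-BRIDGE of row H2-G (owner b2b-balaban-beta-d1-p3), PART 1 of 2 (tools):
# POLYNOMIALLY WEIGHTED PAIRINGS OF A LOCALISED CUBIC STENCIL FAMILY ON `ℤ⁴ × ℤ⁴`, AND THE FINITE ALGEBRA OF TWO WARD PARTNERS

HONEST DEPENDENCY (page 1, mandatory): continuum YM on T⁴ ⇐ BetaPertH ∧ nine spine estimates (0/9 proved); BetaPertH ⇐ (D1) ∧ (D4) ∧ CAP+tail;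
G-an2-4 gates asym, D1 and NE2/3/4.  HONEST FRAMING (cell contract, verbatim): «discharging `BetaPertH` makes Bałaban's UV stability UNCONDITIONAL —
a real constructive-QFT result; it is NOT the continuum limit and NOT the Clay problem.»  THIS MODULE DISCHARGES NOTHING of the wall: it is `ℓ¹` bookkeeping on
`ℤ⁴ × ℤ⁴` and finite index algebra over `Fin 4` ([folklore]; the tree's `ExpKernelCalculus` ∕ `KernelWard` ∕ `FP/StencilMoments` ∕ `FP/CubicGermFunctional` ∕
`FP/WardNormalisation` BY NAME), the tool-box of PART 2 `FP/CubicGermWard` (lattice divergence law ⟹ germ-level `WardGerm`).  No cite, no `def … : Prop`, 0 sorry;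
five DATA definitions asserting nothing (`pairOf`, `linW`, `quadW`, `quadMomentOf`, `quadRowMomentOf`).  NOT H2-G proper, NOT hasym, NOT D1, NOT BetaPertH, NOT continuum, NOT Clay.

ABSOLUTE RULE (cell charter, verbatim): «No internally-minted statement may enter as a cited fact. Every hypothesis is either kernel-proved in this package or a
verbatim quotation of a PUBLISHED theorem with page reference. The manuscript(s) under audit are NOT citable for their own disputed steps — they are the thing
under adjudication; programme-internal (2001/route/tribunal) claims are never citable.»

WHAT IS PROVED.
* §0 FINITE ALGEBRA ON GERM TABLES (`FP/MarginalUniqueness.CubicGerm`, `FP/WardNormalisation.WardGerm`): **`wardGerm_of_twoGerm`** — if the Ward left side of `L`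
  splits as `Q₁(q) − Q₂(p)` with `Q₁(0) = Q₂(0) = 0` then `Q₁ = Q₂` and `WardGerm L Q₂` (test `F(k,k) = 2F(k,0) + 2F(0,k)`); **`germ_snd_eq_neg_transpose`** — (W5)
  `L μ ν a b 1 = −L μ ν b a 0` from ANY germ-level Ward identity (no shape of `Q`); `quad_eq_of_wardGerm` — two Ward partners of one germ vanishing at `0` coincide.
* §1 WEIGHTED PAIRINGS `pairOf S λ μ ν φ := ∑'_{(x,z)} S λ 0 x z (inl μ) (inl ν)·φ x z` of a member of an2's `LocStencil S Cs δ` class (`δ > 0`) against weights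
  `|φ x z| ≤ A(|x|₁+1)^k(|z|₁+1)^k`: `biLoc_jointWeight` (the weighted kernel is `BiLoc` at half rate, `StencilMoments.pow_succ_mul_exp_le'`), `summable_pairOf`,
  `summable_pairOf_shift` + `tsum_shift_eq_pairOf` (the member at legs shifted by `v` pairs as the weight shifted by `−v`, `Equiv.addRight` re-indexing),
  linearity `pairOf_add ∕ _smul ∕ _congr`, the dictionary `pairOf_one` (zeroth moment), `pairOf_fst ∕ _snd` (= `WilsonCubicGerm.cubicGermOf … 0 ∕ 1`,
  THE CONVENTION OF RECORD p236459), the test weights `linW p q = p·x + q·z`, `quadW p q = ½(p·x+q·z)²` with their bounds and frame-vector shifts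
  (`linW_shift`, `quadW_shift`), and **`pairOf_linW`**: `pairOf S λ μ ν (linW p q) = Σ_κ p_κ·cubicGermOf S μ ν λ κ 0 + Σ_κ q_κ·cubicGermOf S μ ν λ κ 1`.
* §2 THE QUADRATIC (second-moment) GERM of a field–field kernel `M : MKer 4 (Fib 3)` through `0`: `quadMomentOf M k μ ν := −½ ∑'_x M x 0 (inl μ) (inl ν) (Σ_κ k_κ x_κ)²`
  (column) and `quadRowMomentOf` (row), vanishing at `k = 0`, and the slices `∑'_x M x 0 · quadW p q x 0 = −quadMomentOf M p`, `∑'_z M 0 z · quadW p q 0 z =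
  −quadRowMomentOf M q` (`tsum_col_quadW ∕ tsum_row_quadW`, unconditional `tsum_mul_left`).
Provenance: G-an2-4 formalisation swarm seat b2b-balaban-gan24-formalise-leaf-02 gen 37 (cross-lane on road FP), 2026-08-20.
-/

noncomputable section

namespace Summit.QuantumFields.BalabanUV.Beta.FP.CubicGermPairing

open Finset
open scoped BigOperators
open Literature.MathematicalPhysics.QuantumFieldTheory.Balaban1983to89
open Literature.MathematicalPhysics.QuantumFieldTheory.Balaban1983to89.Beta
open Literature.MathematicalPhysics.QuantumFieldTheory.Balaban1983to89.B12Sec2to5 (l1 l1_nonneg abs_coord_le_l1)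
open Literature.MathematicalPhysics.QuantumFieldTheory.Balaban1983to89.B6BondElimination (unitVec unitVec_apply)
open Literature.MathematicalPhysics.QuantumFieldTheory.Balaban1983to89.Beta.ExpKernelCalculus (Site MKer BiLoc shiftK)
open Literature.MathematicalPhysics.QuantumFieldTheory.Balaban1983to89.Beta.OneStepResolventKernel (Fib LocStencil)
open Literature.MathematicalPhysics.QuantumFieldTheory.Balaban1983to89.Beta.KernelWard (biLoc_recentre)
open Summit.QuantumFields.BalabanUV.Beta.FP.StencilMoments (pow_succ_mul_exp_le')
open Summit.QuantumFields.BalabanUV.Beta.FP.CubicGermFunctional (summable_prod_of_biLoc)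
open Summit.QuantumFields.BalabanUV.Beta.FP.MarginalUniqueness (Idx CubicGerm)
open Summit.QuantumFields.BalabanUV.Beta.FP.WardNormalisation (WardGerm e)
open Summit.QuantumFields.BalabanUV.Beta.FP.WilsonCubicGerm (cubicGermOf)

/-! ## §0 Finite algebra on germ tables: two Ward partners; (W5) from any Ward identity -/

section Algebra

/-- [folklore] **TWO-GERM WARD ⟹ ONE-GERM WARD.**  If the Ward left side of a cubic germ `L` splits as `Q₁(q) − Q₂(p)` with two quadratic germs both vanishing at
`k = 0`, then `Q₁ = Q₂` (test `F(k,k) = 2F(k,0) + 2F(0,k)`) and `WardGerm L Q₂`. -/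
theorem wardGerm_of_twoGerm {L : CubicGerm} {Q₁ Q₂ : (Idx → ℝ) → Idx → Idx → ℝ} (h₁ : ∀ μ ν, Q₁ 0 μ ν = 0) (h₂ : ∀ μ ν, Q₂ 0 μ ν = 0)
    (h : ∀ (p q : Idx → ℝ) (μ ν : Idx),
      ∑ lam, ∑ κ, (-(p lam + q lam)) * (L μ ν lam κ 0 * p κ + L μ ν lam κ 1 * q κ) = Q₁ q μ ν - Q₂ p μ ν) :
    (∀ k μ ν, Q₁ k μ ν = Q₂ k μ ν) ∧ WardGerm L Q₂ := by
  have hdiag : ∀ k μ ν, Q₁ k μ ν = Q₂ k μ ν := by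
    intro k μ ν
    have hkk := h k k μ ν
    have hk0 := h k 0 μ ν
    have h0k := h 0 k μ ν
    rw [h₂, sub_zero] at h0k
    rw [h₁, zero_sub] at hk0
    have e : ∑ lam, ∑ κ, (-(k lam + k lam)) * (L μ ν lam κ 0 * k κ + L μ ν lam κ 1 * k κ) =
        2 * (∑ lam, ∑ κ, (-(k lam + (0 : Idx → ℝ) lam)) * (L μ ν lam κ 0 * k κ + L μ ν lam κ 1 * (0 : Idx → ℝ) κ)) +
          2 * (∑ lam, ∑ κ, (-((0 : Idx → ℝ) lam + k lam)) * (L μ ν lam κ 0 * (0 : Idx → ℝ) κ + L μ ν lam κ 1 * k κ)) := by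
      rw [Finset.mul_sum, Finset.mul_sum, ← Finset.sum_add_distrib]
      refine Finset.sum_congr rfl fun lam _ => ?_
      rw [Finset.mul_sum, Finset.mul_sum, ← Finset.sum_add_distrib]
      refine Finset.sum_congr rfl fun κ _ => ?_
      simp only [Pi.zero_apply]
      ring
    rw [e, hk0, h0k] at hkk
    linarith
  refine ⟨hdiag, fun p q μ ν => ?_⟩
  rw [h p q μ ν, hdiag q μ ν]

/-- [folklore] **(W5) FROM ANY GERM-LEVEL WARD IDENTITY**: the `q`-block of `L` is minus the transpose of its `p`-block, `L μ ν a b 1 = −L μ ν b a 0`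
(tests `(e_a, e_b)`, `(e_a, 0)`, `(0, e_b)`; no shape of `Q` is used). -/
theorem germ_snd_eq_neg_transpose {L : CubicGerm} {Q : (Idx → ℝ) → Idx → Idx → ℝ} (hW : WardGerm L Q) (μ ν a b : Idx) :
    L μ ν a b 1 = -L μ ν b a 0 := by
  have h1 := hW (e a) (e b) μ ν
  have h2 := hW (e a) 0 μ ν
  have h3 := hW 0 (e b) μ ν
  have key : (∑ lam, ∑ κ, (-(e a lam + e b lam)) * (L μ ν lam κ 0 * e a κ + L μ ν lam κ 1 * e b κ)) -
      (∑ lam, ∑ κ, (-(e a lam + (0 : Idx → ℝ) lam)) * (L μ ν lam κ 0 * e a κ + L μ ν lam κ 1 * (0 : Idx → ℝ) κ)) -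
      (∑ lam, ∑ κ, (-((0 : Idx → ℝ) lam + e b lam)) * (L μ ν lam κ 0 * (0 : Idx → ℝ) κ + L μ ν lam κ 1 * e b κ)) = 0 := by
    rw [h1, h2, h3]; ring
  have inner : ∀ lam, ((∑ κ, (-(e a lam + e b lam)) * (L μ ν lam κ 0 * e a κ + L μ ν lam κ 1 * e b κ)) -
      (∑ κ, (-(e a lam + (0 : Idx → ℝ) lam)) * (L μ ν lam κ 0 * e a κ + L μ ν lam κ 1 * (0 : Idx → ℝ) κ)) -
      (∑ κ, (-((0 : Idx → ℝ) lam + e b lam)) * (L μ ν lam κ 0 * (0 : Idx → ℝ) κ + L μ ν lam κ 1 * e b κ))) =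
      -(e a lam * L μ ν lam b 1 + e b lam * L μ ν lam a 0) := by
    intro lam
    rw [← Finset.sum_sub_distrib, ← Finset.sum_sub_distrib]
    have : ∀ κ, (-(e a lam + e b lam)) * (L μ ν lam κ 0 * e a κ + L μ ν lam κ 1 * e b κ) -
        (-(e a lam + (0 : Idx → ℝ) lam)) * (L μ ν lam κ 0 * e a κ + L μ ν lam κ 1 * (0 : Idx → ℝ) κ) -
        (-((0 : Idx → ℝ) lam + e b lam)) * (L μ ν lam κ 0 * (0 : Idx → ℝ) κ + L μ ν lam κ 1 * e b κ) =
        -(e a lam * (L μ ν lam κ 1 * e b κ) + e b lam * (L μ ν lam κ 0 * e a κ)) := by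
      intro κ; simp only [Pi.zero_apply]; ring
    simp only [this, Finset.sum_neg_distrib, Finset.sum_add_distrib, ← Finset.mul_sum]
    simp only [e, mul_ite, mul_one, mul_zero, Finset.sum_ite_eq', Finset.mem_univ, if_true]
  rw [← Finset.sum_sub_distrib, ← Finset.sum_sub_distrib] at key
  simp only [inner, Finset.sum_neg_distrib, Finset.sum_add_distrib] at key
  simp only [e, ite_mul, one_mul, zero_mul, Finset.sum_ite_eq', Finset.mem_univ, if_true] at key
  linarith

/-- [folklore] **TWO WARD PARTNERS OF ONE GERM, BOTH VANISHING AT `k = 0`, COINCIDE.** -/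
theorem quad_eq_of_wardGerm {L : CubicGerm} {Q Q' : (Idx → ℝ) → Idx → Idx → ℝ} (hW : WardGerm L Q) (hW' : WardGerm L Q')
    (h0 : ∀ μ ν, Q 0 μ ν = 0) (h0' : ∀ μ ν, Q' 0 μ ν = 0) (k : Idx → ℝ) (μ ν : Idx) : Q k μ ν = Q' k μ ν := by
  have h1 := hW 0 k μ ν
  have h2 := hW' 0 k μ ν
  rw [h0, sub_zero] at h1
  rw [h0', sub_zero] at h2
  rw [← h1, ← h2]

end Algebra

/-! ## §1 Weighted pairings of a localised stencil member: the test weights, summability, linearity -/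

section Pairing

variable {S : Fin 4 → Site 4 → MKer 4 (Fib 3)} {Cs δ : ℝ}

/-- [our object] THE PAIRING of the field–field member with background bond `(λ, 0)` against a weight `φ` on pairs of sites:
`pairOf S λ μ ν φ = ∑'_{(x,z)} S λ 0 x z (inl μ) (inl ν) · φ x z`.  A definition asserting nothing. -/
def pairOf (S : Fin 4 → Site 4 → MKer 4 (Fib 3)) (lam μ ν : Fin 4) (φ : Site 4 → Site 4 → ℝ) : ℝ :=
  ∑' xz : Site 4 × Site 4, S lam 0 xz.1 xz.2 (Sum.inl μ) (Sum.inl ν) * φ xz.1 xz.2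

/-- [our object] THE LINEAR TEST WEIGHT `p·x + q·z`.  A definition asserting nothing. -/
def linW (p q : Fin 4 → ℝ) (x z : Site 4) : ℝ := (∑ κ, p κ * (x κ : ℝ)) + ∑ κ, q κ * (z κ : ℝ)

/-- [our object] THE QUADRATIC TEST WEIGHT `½(p·x + q·z)²`.  A definition asserting nothing. -/
def quadW (p q : Fin 4 → ℝ) (x z : Site 4) : ℝ := (1 / 2 : ℝ) * linW p q x z ^ 2

/-- [folklore] **A JOINT POLYNOMIAL WEIGHT KEEPS BI-LOCALISATION AT `(0,0)` (half rate)** (any dimension, any fibre):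
`BiLoc K 0 0 C δ`, `|φ x z| ≤ A(|x|₁+1)^k(|z|₁+1)^k` ⟹ `BiLoc (K·φ) 0 0 (C·A·(k!e^{δ/2}(2/δ)^k)²) (δ/2)`. -/
theorem biLoc_jointWeight {D : ℕ} {F : Type*} {K : MKer D F} {C δ' A : ℝ} {k : ℕ} (hK : BiLoc K 0 0 C δ') (hδ : 0 < δ') (hA : 0 ≤ A)
    {φ : Site D → Site D → ℝ} (hφ : ∀ x z, |φ x z| ≤ A * ((l1 x + 1) ^ k * (l1 z + 1) ^ k)) :
    BiLoc (fun x z a b => K x z a b * φ x z) 0 0 (C * A * ((k.factorial : ℝ) * Real.exp (δ' / 2) * (2 / δ') ^ k) ^ 2) (δ' / 2) := by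
  intro x z a b
  have hC : 0 ≤ C := hK.nonneg a
  have h1 := hK x z a b
  have h2 := hφ x z
  have hlx := l1_nonneg x
  have hlz := l1_nonneg z
  rw [sub_zero, sub_zero] at h1
  show |K x z a b * φ x z| ≤ _ * Real.exp (-(δ' / 2) * (l1 (x - 0) + l1 (z - 0)))
  rw [sub_zero, sub_zero, abs_mul]
  have hx := pow_succ_mul_exp_le' k hδ hlx
  have hz := pow_succ_mul_exp_le' k hδ hlz
  calc |K x z a b| * |φ x z| ≤ (C * Real.exp (-δ' * (l1 x + l1 z))) * (A * ((l1 x + 1) ^ k * (l1 z + 1) ^ k)) :=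
        mul_le_mul h1 h2 (abs_nonneg _) (by positivity)
    _ = C * A * (((l1 x + 1) ^ k * Real.exp (-δ' * l1 x)) * ((l1 z + 1) ^ k * Real.exp (-δ' * l1 z))) := by
        rw [show -δ' * (l1 x + l1 z) = -δ' * l1 x + -δ' * l1 z by ring, Real.exp_add]; ring
    _ ≤ C * A * ((((k.factorial : ℝ) * Real.exp (δ' / 2) * (2 / δ') ^ k) * Real.exp (-(δ' / 2) * l1 x)) *
          ((((k.factorial : ℝ) * Real.exp (δ' / 2) * (2 / δ') ^ k) * Real.exp (-(δ' / 2) * l1 z)))) := by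
        apply mul_le_mul_of_nonneg_left _ (mul_nonneg hC hA)
        exact mul_le_mul hx hz (by positivity) (by positivity)
    _ = C * A * ((k.factorial : ℝ) * Real.exp (δ' / 2) * (2 / δ') ^ k) ^ 2 * Real.exp (-(δ' / 2) * (l1 x + l1 z)) := by
        rw [show -(δ' / 2) * (l1 x + l1 z) = -(δ' / 2) * l1 x + -(δ' / 2) * l1 z by ring, Real.exp_add]; ring

/-- [folklore] A SHIFTED member `shiftK v (S λ 0)` of a `LocStencil` family is bi-localised at `(0,0)` (recentring costs `e^{2δ|v|₁}`). -/
theorem biLoc_shiftK (hS : LocStencil S Cs δ) (hδ : 0 < δ) (lam : Fin 4) (v : Site 4) :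
    BiLoc (shiftK v (S lam 0)) 0 0 (Cs * Real.exp (δ * (l1 (-v - 0) + l1 (-v - 0)))) δ := by
  have h : BiLoc (shiftK v (S lam 0)) (-v) (-v) Cs δ := by
    intro x z a b
    have := hS lam 0 (x + v) (z + v) a b
    simpa [shiftK, sub_neg_eq_add] using this
  exact biLoc_recentre h hδ.le 0 0

/-- [folklore] **SUMMABILITY OF A WEIGHTED PAIRING** on `ℤ⁴ × ℤ⁴` for a polynomial weight. -/
theorem summable_pairOf (hS : LocStencil S Cs δ) (hδ : 0 < δ) {φ : Site 4 → Site 4 → ℝ} {A : ℝ} {k : ℕ} (hA : 0 ≤ A)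
    (hφ : ∀ x z, |φ x z| ≤ A * ((l1 x + 1) ^ k * (l1 z + 1) ^ k)) (lam μ ν : Fin 4) :
    Summable fun xz : Site 4 × Site 4 => S lam 0 xz.1 xz.2 (Sum.inl μ) (Sum.inl ν) * φ xz.1 xz.2 :=
  summable_prod_of_biLoc (biLoc_jointWeight (hS lam 0) hδ hA hφ) (half_pos hδ) (Sum.inl μ) (Sum.inl ν)

/-- [folklore] … and of the SHIFTED weighted pairing `(x,z) ↦ S λ 0 (x+v) (z+v) · φ x z`. -/
theorem summable_pairOf_shift (hS : LocStencil S Cs δ) (hδ : 0 < δ) {φ : Site 4 → Site 4 → ℝ} {A : ℝ} {k : ℕ} (hA : 0 ≤ A)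
    (hφ : ∀ x z, |φ x z| ≤ A * ((l1 x + 1) ^ k * (l1 z + 1) ^ k)) (lam μ ν : Fin 4) (v : Site 4) :
    Summable fun xz : Site 4 × Site 4 => S lam 0 (xz.1 + v) (xz.2 + v) (Sum.inl μ) (Sum.inl ν) * φ xz.1 xz.2 :=
  summable_prod_of_biLoc (biLoc_jointWeight (biLoc_shiftK hS hδ lam v) hδ hA hφ) (half_pos hδ) (Sum.inl μ) (Sum.inl ν)

/-- [folklore] RE-INDEXING: the shifted pairing is the pairing against the oppositely shifted weight. -/
theorem tsum_shift_eq_pairOf (S : Fin 4 → Site 4 → MKer 4 (Fib 3)) (lam μ ν : Fin 4) (φ : Site 4 → Site 4 → ℝ) (v : Site 4) :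
    ∑' xz : Site 4 × Site 4, S lam 0 (xz.1 + v) (xz.2 + v) (Sum.inl μ) (Sum.inl ν) * φ xz.1 xz.2 =
      pairOf S lam μ ν (fun x z => φ (x - v) (z - v)) := by
  unfold pairOf
  refine Eq.trans ?_ (((Equiv.addRight v).prodCongr (Equiv.addRight v)).tsum_eq
    (fun xz : Site 4 × Site 4 => S lam 0 xz.1 xz.2 (Sum.inl μ) (Sum.inl ν) * φ (xz.1 - v) (xz.2 - v)))
  refine tsum_congr fun xz => ?_
  simp only [Equiv.prodCongr_apply, Prod.map_fst, Prod.map_snd, Equiv.coe_addRight, add_sub_cancel_right]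

/-- [folklore] pairings against pointwise-equal weights agree. -/
theorem pairOf_congr (S : Fin 4 → Site 4 → MKer 4 (Fib 3)) (lam μ ν : Fin 4) {φ ψ : Site 4 → Site 4 → ℝ} (h : ∀ x z, φ x z = ψ x z) :
    pairOf S lam μ ν φ = pairOf S lam μ ν ψ := by
  unfold pairOf
  exact tsum_congr fun xz => by rw [h]

/-- [folklore] ADDITIVITY of the pairing in the weight (both pairings summable; `∑'` is not additive otherwise). -/
theorem pairOf_add (lam μ ν : Fin 4) (φ ψ : Site 4 → Site 4 → ℝ)
    (hφ : Summable fun xz : Site 4 × Site 4 => S lam 0 xz.1 xz.2 (Sum.inl μ) (Sum.inl ν) * φ xz.1 xz.2)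
    (hψ : Summable fun xz : Site 4 × Site 4 => S lam 0 xz.1 xz.2 (Sum.inl μ) (Sum.inl ν) * ψ xz.1 xz.2) :
    pairOf S lam μ ν (fun x z => φ x z + ψ x z) = pairOf S lam μ ν φ + pairOf S lam μ ν ψ := by
  unfold pairOf
  simp only [mul_add]
  exact (hφ.hasSum.add hψ.hasSum).tsum_eq

/-- [folklore] HOMOGENEITY (unconditional). -/
theorem pairOf_smul (S : Fin 4 → Site 4 → MKer 4 (Fib 3)) (lam μ ν : Fin 4) (a : ℝ) (φ : Site 4 → Site 4 → ℝ) :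
    pairOf S lam μ ν (fun x z => a * φ x z) = a * pairOf S lam μ ν φ := by
  unfold pairOf
  rw [← tsum_mul_left]
  exact tsum_congr fun xz => by ring

/-- [folklore] the pairing against the constant weight `1` is the ZEROTH MOMENT. -/
theorem pairOf_one (S : Fin 4 → Site 4 → MKer 4 (Fib 3)) (lam μ ν : Fin 4) :
    pairOf S lam μ ν (fun _ _ => 1) = ∑' xz : Site 4 × Site 4, S lam 0 xz.1 xz.2 (Sum.inl μ) (Sum.inl ν) := by
  unfold pairOf
  simp only [mul_one]

/-- [folklore] the pairing against a ROW coordinate is the `p`-part of the cubic germ (the CONVENTION OF RECORD `cubicGermOf`, p236459). -/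
theorem pairOf_fst (S : Fin 4 → Site 4 → MKer 4 (Fib 3)) (lam μ ν κ : Fin 4) :
    pairOf S lam μ ν (fun x _ => (x κ : ℝ)) = cubicGermOf S μ ν lam κ 0 := by
  unfold pairOf cubicGermOf
  simp only [Fin.isValue, ↓reduceIte]

/-- [folklore] the pairing against a COLUMN coordinate is the `q`-part of the cubic germ. -/
theorem pairOf_snd (S : Fin 4 → Site 4 → MKer 4 (Fib 3)) (lam μ ν κ : Fin 4) :
    pairOf S lam μ ν (fun _ z => (z κ : ℝ)) = cubicGermOf S μ ν lam κ 1 := by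
  unfold pairOf cubicGermOf
  simp only [Fin.isValue, one_ne_zero, ↓reduceIte]

/-! ### The test weights: bounds, shifts, slices -/

/-- [folklore] `|x|₁ ≤ (|x|₁+1)^j (|z|₁+1)^j` for `j ≥ 1`. -/
theorem l1_le_weight (x z : Site 4) {j : ℕ} (hj : 1 ≤ j) : l1 x ≤ (l1 x + 1) ^ j * (l1 z + 1) ^ j := by
  have hx := l1_nonneg x
  have hz := l1_nonneg z
  have h1 : l1 x ≤ l1 x + 1 := by linarith
  have h2 : l1 x + 1 ≤ (l1 x + 1) ^ j := le_self_pow₀ (by linarith) (by omega)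
  have h3 : (1 : ℝ) ≤ (l1 z + 1) ^ j := one_le_pow₀ (by linarith)
  calc l1 x ≤ (l1 x + 1) ^ j := h1.trans h2
    _ = (l1 x + 1) ^ j * 1 := (mul_one _).symm
    _ ≤ (l1 x + 1) ^ j * (l1 z + 1) ^ j := mul_le_mul_of_nonneg_left h3 (by positivity)

/-- [folklore] the constant weight: `|1| ≤ 1·(|x|₁+1)^0(|z|₁+1)^0`. -/
theorem abs_one_le_weight (x z : Site 4) : |(1 : ℝ)| ≤ 1 * ((l1 x + 1) ^ 0 * (l1 z + 1) ^ 0) := by simp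

/-- [folklore] a row coordinate: `|x_κ| ≤ 1·(|x|₁+1)(|z|₁+1)`. -/
theorem abs_fst_le_weight (κ : Fin 4) (x z : Site 4) : |(x κ : ℝ)| ≤ 1 * ((l1 x + 1) ^ 1 * (l1 z + 1) ^ 1) := by
  rw [one_mul]
  exact (abs_coord_le_l1 x κ).trans (l1_le_weight x z le_rfl)

/-- [folklore] a column coordinate: `|z_κ| ≤ 1·(|x|₁+1)(|z|₁+1)`. -/
theorem abs_snd_le_weight (κ : Fin 4) (x z : Site 4) : |(z κ : ℝ)| ≤ 1 * ((l1 x + 1) ^ 1 * (l1 z + 1) ^ 1) := by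
  rw [one_mul, mul_comm]
  exact (abs_coord_le_l1 z κ).trans (l1_le_weight z x le_rfl)

/-- [folklore] `|Σ_κ k_κ x_κ| ≤ (Σ_κ |k_κ|)·|x|₁`. -/
theorem abs_dot_le (k : Fin 4 → ℝ) (x : Site 4) : |∑ κ, k κ * (x κ : ℝ)| ≤ (∑ κ, |k κ|) * l1 x := by
  calc |∑ κ, k κ * (x κ : ℝ)| ≤ ∑ κ, |k κ * (x κ : ℝ)| := Finset.abs_sum_le_sum_abs _ _
    _ = ∑ κ, |k κ| * |(x κ : ℝ)| := Finset.sum_congr rfl fun κ _ => abs_mul _ _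
    _ ≤ ∑ κ, |k κ| * l1 x := Finset.sum_le_sum fun κ _ => mul_le_mul_of_nonneg_left (abs_coord_le_l1 x κ) (abs_nonneg _)
    _ = (∑ κ, |k κ|) * l1 x := by rw [Finset.sum_mul]

/-- [folklore] the linear weight: `|p·x + q·z| ≤ (Σ|p_κ| + Σ|q_κ|)·(|x|₁+1)(|z|₁+1)`. -/
theorem abs_linW_le (p q : Fin 4 → ℝ) (x z : Site 4) :
    |linW p q x z| ≤ ((∑ κ, |p κ|) + ∑ κ, |q κ|) * ((l1 x + 1) ^ 1 * (l1 z + 1) ^ 1) := by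
  have hP : 0 ≤ ∑ κ, |p κ| := Finset.sum_nonneg fun κ _ => abs_nonneg _
  have hQ : 0 ≤ ∑ κ, |q κ| := Finset.sum_nonneg fun κ _ => abs_nonneg _
  have hx := l1_le_weight x z (le_refl 1)
  have hz := l1_le_weight z x (le_refl 1)
  rw [mul_comm ((l1 z + 1) ^ 1)] at hz
  unfold linW
  calc |(∑ κ, p κ * (x κ : ℝ)) + ∑ κ, q κ * (z κ : ℝ)| ≤ |∑ κ, p κ * (x κ : ℝ)| + |∑ κ, q κ * (z κ : ℝ)| := abs_add_le _ _
    _ ≤ (∑ κ, |p κ|) * l1 x + (∑ κ, |q κ|) * l1 z := add_le_add (abs_dot_le p x) (abs_dot_le q z)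
    _ ≤ (∑ κ, |p κ|) * ((l1 x + 1) ^ 1 * (l1 z + 1) ^ 1) + (∑ κ, |q κ|) * ((l1 x + 1) ^ 1 * (l1 z + 1) ^ 1) :=
        add_le_add (mul_le_mul_of_nonneg_left hx hP) (mul_le_mul_of_nonneg_left hz hQ)
    _ = ((∑ κ, |p κ|) + ∑ κ, |q κ|) * ((l1 x + 1) ^ 1 * (l1 z + 1) ^ 1) := by ring

/-- [folklore] the quadratic weight: `|½(p·x + q·z)²| ≤ ½(Σ|p_κ| + Σ|q_κ|)²·(|x|₁+1)²(|z|₁+1)²`. -/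
theorem abs_quadW_le (p q : Fin 4 → ℝ) (x z : Site 4) :
    |quadW p q x z| ≤ ((1 / 2 : ℝ) * (((∑ κ, |p κ|) + ∑ κ, |q κ|) ^ 2)) * ((l1 x + 1) ^ 2 * (l1 z + 1) ^ 2) := by
  have h := abs_linW_le p q x z
  have hsq : linW p q x z ^ 2 ≤ (((∑ κ, |p κ|) + ∑ κ, |q κ|) * ((l1 x + 1) ^ 1 * (l1 z + 1) ^ 1)) ^ 2 := by
    rw [← sq_abs (linW p q x z)]
    exact pow_le_pow_left₀ (abs_nonneg _) h 2
  unfold quadW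
  rw [abs_mul, abs_of_pos (by norm_num : (0 : ℝ) < 1 / 2), abs_of_nonneg (sq_nonneg _)]
  calc (1 / 2 : ℝ) * linW p q x z ^ 2 ≤ (1 / 2 : ℝ) * (((∑ κ, |p κ|) + ∑ κ, |q κ|) * ((l1 x + 1) ^ 1 * (l1 z + 1) ^ 1)) ^ 2 :=
        mul_le_mul_of_nonneg_left hsq (by norm_num)
    _ = ((1 / 2 : ℝ) * (((∑ κ, |p κ|) + ∑ κ, |q κ|) ^ 2)) * ((l1 x + 1) ^ 2 * (l1 z + 1) ^ 2) := by ring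

/-- [folklore] SHIFT OF THE LINEAR WEIGHT by a frame vector: `linW p q (x − e_λ) (z − e_λ) = linW p q x z − (p_λ + q_λ)`. -/
theorem linW_shift (p q : Fin 4 → ℝ) (x z : Site 4) (lam : Fin 4) :
    linW p q (x - unitVec lam) (z - unitVec lam) = linW p q x z - (p lam + q lam) := by
  unfold linW
  simp only [Pi.sub_apply, unitVec_apply, Int.cast_sub, Int.cast_ite, Int.cast_one, Int.cast_zero, mul_sub, Finset.sum_sub_distrib,
    mul_ite, mul_one, mul_zero, Finset.sum_ite_eq', Finset.mem_univ, if_true]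
  ring

/-- [folklore] SHIFT OF THE QUADRATIC WEIGHT: `quadW p q (x − e_λ) (z − e_λ) = quadW p q x z + (−(p_λ+q_λ)·linW p q x z + ½(p_λ+q_λ)²·1)`. -/
theorem quadW_shift (p q : Fin 4 → ℝ) (x z : Site 4) (lam : Fin 4) :
    quadW p q (x - unitVec lam) (z - unitVec lam) =
      quadW p q x z + (-(p lam + q lam) * linW p q x z + (1 / 2 : ℝ) * (p lam + q lam) ^ 2 * 1) := by
  unfold quadW
  rw [linW_shift]
  ring

/-- [folklore] the linear weight on the column slice `z = 0`: `linW p q x 0 = p·x`; on the row slice: `linW p q 0 z = q·z`. -/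
theorem linW_slices (p q : Fin 4 → ℝ) (x z : Site 4) :
    linW p q x 0 = ∑ κ, p κ * (x κ : ℝ) ∧ linW p q 0 z = ∑ κ, q κ * (z κ : ℝ) := by
  unfold linW
  simp only [Pi.zero_apply, Int.cast_zero, mul_zero, Finset.sum_const_zero, add_zero, zero_add, and_self]

/-- [folklore] **THE PAIRING OF THE LINEAR WEIGHT IS THE GERM CONTRACTED WITH THE MOMENTA**:
`pairOf S λ μ ν (linW p q) = Σ_κ p_κ·cubicGermOf S μ ν λ κ 0 + Σ_κ q_κ·cubicGermOf S μ ν λ κ 1`. -/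
theorem pairOf_linW (hS : LocStencil S Cs δ) (hδ : 0 < δ) (p q : Fin 4 → ℝ) (lam μ ν : Fin 4) :
    pairOf S lam μ ν (linW p q) = (∑ κ, p κ * cubicGermOf S μ ν lam κ 0) + ∑ κ, q κ * cubicGermOf S μ ν lam κ 1 := by
  have h0 : ∀ κ ∈ (Finset.univ : Finset (Fin 4)), HasSum (fun xz : Site 4 × Site 4 =>
      S lam 0 xz.1 xz.2 (Sum.inl μ) (Sum.inl ν) * (p κ * (xz.1 κ : ℝ))) (p κ * cubicGermOf S μ ν lam κ 0) := by
    intro κ _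
    have e0 := pairOf_fst S lam μ ν κ
    unfold pairOf at e0
    have h := (summable_pairOf hS hδ zero_le_one (abs_fst_le_weight κ) lam μ ν).hasSum.mul_left (p κ)
    rw [e0] at h
    exact h.congr_fun fun xz => by ring
  have h1 : ∀ κ ∈ (Finset.univ : Finset (Fin 4)), HasSum (fun xz : Site 4 × Site 4 =>
      S lam 0 xz.1 xz.2 (Sum.inl μ) (Sum.inl ν) * (q κ * (xz.2 κ : ℝ))) (q κ * cubicGermOf S μ ν lam κ 1) := by
    intro κ _
    have e1 := pairOf_snd S lam μ ν κ
    unfold pairOf at e1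
    have h := (summable_pairOf hS hδ zero_le_one (abs_snd_le_weight κ) lam μ ν).hasSum.mul_left (q κ)
    rw [e1] at h
    exact h.congr_fun fun xz => by ring
  have hsum := (hasSum_sum h0).add (hasSum_sum h1)
  unfold pairOf linW
  refine (hsum.congr_fun fun xz => ?_).tsum_eq
  rw [mul_add, Finset.mul_sum, Finset.mul_sum]

end Pairing

/-! ## §2 The quadratic germ of a field–field kernel (column ∕ row through `0`) and the slices of the quadratic test weight -/

section Defs

/-- [our object] **THE QUADRATIC (second-moment) GERM OF A FIELD–FIELD KERNEL, COLUMN THROUGH `0`**: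
`quadMomentOf M k μ ν = −½ ∑'_x M x 0 (inl μ) (inl ν) (Σ_κ k_κ x_κ)²`.  A definition asserting nothing.  READING FOR CONSUMERS (owner d1-p3, journal
l.22081): when `M` is the field–field block of a gauge- and lattice-invariant quadratic form, `c · quadMomentOf M` is to be identified with
`WardNormalisation.quadGerm cQ 0 0` (the isotropic transverse germ) and fed BY NAME — as the hypothesis `c · quadMomentOf M = quadGerm cQ α γ` of
`CubicGermWard.cubicGermOf_eq_of_law_anti13` — with `cQ` the quadratic form's germ coefficient (on the perfect side: the `PerfectSymbol166.W166lim_zero`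
normalisation); the KERNEL-CHECKED instance is `CubicGermWard.half_quadMomentOf_bhK`: `½ · quadMomentOf (bhK 1) = quadGerm 1 0 0` (the `d*d` window,
`cQ = 1` for the contact form `½·d*d`).  Nothing about any other `M` is asserted here. -/
def quadMomentOf (M : MKer 4 (Fib 3)) (k : Fin 4 → ℝ) (μ ν : Fin 4) : ℝ :=
  -(1 / 2 : ℝ) * ∑' x : Site 4, M x 0 (Sum.inl μ) (Sum.inl ν) * (∑ κ, k κ * (x κ : ℝ)) ^ 2

/-- [our object] the same through the ROW: `quadRowMomentOf M k μ ν = −½ ∑'_z M 0 z (inl μ) (inl ν) (Σ_κ k_κ z_κ)²` (equal to the column one under the law,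
`quadRowMomentOf_eq`).  A definition asserting nothing. -/
def quadRowMomentOf (M : MKer 4 (Fib 3)) (k : Fin 4 → ℝ) (μ ν : Fin 4) : ℝ :=
  -(1 / 2 : ℝ) * ∑' z : Site 4, M 0 z (Sum.inl μ) (Sum.inl ν) * (∑ κ, k κ * (z κ : ℝ)) ^ 2

/-- [folklore] `quadMomentOf M 0 = 0`. -/
theorem quadMomentOf_zero (M : MKer 4 (Fib 3)) (μ ν : Fin 4) : quadMomentOf M 0 μ ν = 0 := by
  simp [quadMomentOf]

/-- [folklore] `quadRowMomentOf M 0 = 0`. -/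
theorem quadRowMomentOf_zero (M : MKer 4 (Fib 3)) (μ ν : Fin 4) : quadRowMomentOf M 0 μ ν = 0 := by
  simp [quadRowMomentOf]

/-- [folklore] the column slice of the quadratic test weight pairs to MINUS the quadratic column germ: `∑'_x M x 0 · quadW p q x 0 = −quadMomentOf M p`. -/
theorem tsum_col_quadW (M : MKer 4 (Fib 3)) (p q : Fin 4 → ℝ) (μ ν : Fin 4) :
    ∑' x : Site 4, M x 0 (Sum.inl μ) (Sum.inl ν) * quadW p q x 0 = -quadMomentOf M p μ ν := by
  unfold quadMomentOf quadW
  rw [neg_mul, neg_neg, ← tsum_mul_left]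
  refine tsum_congr fun x => ?_
  rw [(linW_slices p q x 0).1]
  ring

/-- [folklore] the row slice: `∑'_z M 0 z · quadW p q 0 z = −quadRowMomentOf M q`. -/
theorem tsum_row_quadW (M : MKer 4 (Fib 3)) (p q : Fin 4 → ℝ) (μ ν : Fin 4) :
    ∑' z : Site 4, M 0 z (Sum.inl μ) (Sum.inl ν) * quadW p q 0 z = -quadRowMomentOf M q μ ν := by
  unfold quadRowMomentOf quadW
  rw [neg_mul, neg_neg, ← tsum_mul_left]
  refine tsum_congr fun z => ?_
  rw [(linW_slices p q 0 z).2]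
  ring

end Defs

end Summit.QuantumFields.BalabanUV.Beta.FP.CubicGermPairing
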